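import Literature.NumberTheory.Automorphic.CartanIwasawaUniquenessGL
import Literature.NumberTheory.Automorphic.GLnHeckeRingCommutative
import HarnessLib

/-!
# Integral leading terms of the counting Satake transform of `ℋ(GL_n(F), GL_n(𝒪); R)` and the algebraic independence of
# the elementary Hecke operators `c_{(1^r)}` over EVERY commutative coefficient ring (Macdonald Ch. V (2.6)–(2.7); Cartier
# 1979, proof of Thm. 4.1 (c); Bruhat–Tits (4.4.4))

Topic `NumberTheory/Automorphic`; namespace `Literature.NumberTheory.Automorphic` (lane `lit-hodgefound`, Track 2
foundations; seat `lit-hodgefound-p11`, generation 42, row g42-#2).  THEOREMS ONLY: no definition, no named fact, no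
instance, no notation.  Sequel of `CartanIwasawaUniquenessGL` (g42-#1: Bruhat–Tits (4.4.4) (ii) for `GL_n`, the Satake
transform is injective over every commutative ring, the coefficient of `x^a` in `𝒮_w(T_{ϖ^a})` is the unit `w(a)` for `a`
monotone) and of `SatakeTransformGLAlgebraicIndependence` (g41-#7: the same programme over `ℂ`, where the leading
coefficients are powers of `q`, hence the restriction to characteristic `0`).

## The print and the method

[Macdonald1995] Ch. V (2.3) «The `c_λ` […] form a `ℤ`-basis of `H(G, K)`», (2.6) `c_μ * c_ν = Σ_λ g^λ_{μν}(q) c_λ`, (2.7)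
«the `ℤ`-linear mapping `θ` of `H(G⁺, K)` into `Λ_n[q⁻¹]` […] is an injective ring homomorphism» (so the `c_{(1^r)}`,
`θ(c_{(1^r)}) = q^{-r(r-1)/2} e_r`, are algebraically independent); [CartierCorvallis1979] §IV, proof of Thm. 4.1 (c):
«`Sc_λ = Σ_μ c(λ, μ) χ_μ` with `c(λ, λ) ≠ 0` [in fact `= δ(λ)^{1/2}`] and `c(λ, μ) = 0` unless `μ ≤ λ`».  INTEGRAL FORM
(this file): work with the COUNTING transform `𝒮_1 : ℋ(G, K; R) → R[ℤⁿ]` (`IsIwasawaExponent.satakeTransform` with weight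
`w = 1`: the coefficient of `x^μ` in `𝒮_1(T_g)` is the NUMBER of cosets of `KgK` with Iwasawa exponent `μ`) and index the
Cartan double cosets by their MONOTONE exponent `a` (antidominant for the upper Borel).  Then `𝒮_1(T_{ϖ^a})` is
«co-triangular with bottom `a`»: every exponent `μ` occurring is dominance-ABOVE `a` (`Σ_{i<s} a_i ≤ Σ_{i<s} μ_i` for all
`s`, g42-#1 `sum_ite_lt_le_sum_ite_lt_iwasawaExp_of_mem_orbit`) and the coefficient of `x^a` is EXACTLY `1`
(Bruhat–Tits (4.4.4) (ii), g42-#1 `coeff_satakeTransform_doubleCosetOperator_zpowDiagGL_monotone`).  Products of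
co-triangular elements are co-triangular with the bottoms added and the bottom coefficients multiplied (§1), elements
with distinct bottoms and unit bottom coefficients are linearly independent over ANY commutative ring (§1), so the
ordered monomials in the `c_{(1^r)} = T_{ϖ^{(1^r, 0^{n-r})}} = T_{ϖ^{(0^{n-r}, 1^r)}}` have linearly independent
transforms with bottoms `Σ_r α_r (0^{n-r}, 1^r)` (§2), and the `c_{(1^r)}` are algebraically independent in the
commutative ring `ℋ(GL_n(F), GL_n(𝒪_F); R)` for every commutative `R` and every `F` whose valuation ring is a DVR
(§3) — no finiteness, completeness or characteristic hypothesis beyond the Hecke-pair instance.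

## What is formalised (theorems only; `HS_s(μ) = Σ_{i<s} μ_i` is spelled `∑ i, if (i : ℕ) < s then μ i else 0`)

* §1 (`R` any commutative ring, `R[ℤⁿ] = AddMonoidAlgebra R (Fin n → ℤ)`): `sum_ite_lt_add`, `sum_ite_lt_nsmul`,
  `sum_ite_lt_finset_sum`, `forall_sum_ite_lt_le_of_coeff_mul_ne_zero` (bottoms add under products),
  **`coeff_mul_add_eq_mul_coeff_of_forall_sum_ite_lt_le`** (bottom coefficients multiply — no non-vanishing hypothesis),
  `eq_zero_of_coeff_one_ne_zero`, `coeff_one_zero_eq_one`, `forall_sum_ite_lt_le_and_coeff_pow`,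
  **`forall_sum_ite_lt_le_and_coeff_prod_pow`** (monomials: bottom `Σ_r α_r t_r`, coefficient `Π_r c_r^{α_r}`),
  **`linearIndependent_of_forall_sum_ite_lt_le_of_isUnit`** (distinct bottoms + unit bottom coefficients ⇒ linearly
  independent over `R`).
* §2 (`F` with `ValuativeRel`, `𝒪[F]` a DVR, `ϖ` uniformizing, `(GL_n(F), GL_n(𝒪))` a Hecke pair):
  **`forall_sum_ite_lt_le_of_coeff_satakeTransform_zpowDiagGL_ne_zero`** (`𝒮_w(T_{ϖ^a})`, `a` monotone, is
  co-triangular with bottom `a`), `coeff_satakeTransform_one_doubleCosetOperator_zpowDiagGL_monotone` (counting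
  transform: bottom coefficient `1`), `monotone_indicator_rev_le`, `doubleCosetOperator_zpowDiagGL_indicator_le_eq_rev`
  (`c_{(1^{r+1})}`: the antitone exponent `(1^{r+1}, 0)` and the monotone one `(0, 1^{r+1})` give the same operator),
  `injective_sum_nsmul_indicator_rev_le` (`α ↦ Σ_r α_r (0, 1^{r+1})` is injective),
  **`forall_sum_ite_lt_le_and_coeff_satakeTransform_one_monomial`** (the counting transform of an ordered monomial in
  the `c_{(1^r)}` has bottom `Σ_r α_r (0, 1^{r+1})` with coefficient `1`).
* §3 **`linearIndependent_glInt_monomials_zpowDiagGL_of_commRing`**,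
  **`algebraicIndependent_glInt_doubleCosetOperator_zpowDiagGL_of_commRing`** (MACDONALD (2.7) / TAMAGAWA INTEGRALLY:
  the `c_{(1^r)}`, `1 ≤ r ≤ n`, are algebraically independent over EVERY commutative `R`),
  `exists_algEquiv_mvPolynomial_adjoin_glInt_zpowDiagGL_of_commRing` (`R[c_{(1)}, …, c_{(1ⁿ)}] ≅ R[X_1, …, X_n]`).

## References
* [Macdonald1995] I. G. Macdonald, *Symmetric Functions and Hall Polynomials*, 2nd ed. (1995), Ch. I §1 (dominance order),
  Ch. V (2.3), (2.6)–(2.7) (PDF pp. 245–246).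
* [CartierCorvallis1979] P. Cartier, *Representations of 𝔭-adic groups: a survey*, PSPM 33.1 (1979), §IV Thm. 4.1, proof
  (b)–(c).
* [BruhatTits1972] F. Bruhat, J. Tits, *Groupes réductifs sur un corps local. I*, Publ. Math. IHÉS 41 (1972), Prop. (4.4.4).
-/

noncomputable section

open scoped MatrixGroups Pointwise
open ValuativeRel Matrix Finset MonoidAlgebra Representation MulAction

namespace Literature.NumberTheory.Automorphic

open Literature.NumberTheory.Automorphic.CartanUnique Literature.NumberTheory.Automorphic.HermitianLattice

/-! ## §1 Bottom terms for the dominance order in `R[ℤⁿ]`, over any commutative ring `R` -/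

section BottomTerms

variable {n : ℕ} {R : Type*} [CommRing R]

/-- Head sums are additive. [cite: Macdonald1995, Ch. I §1] -/
theorem sum_ite_lt_add (μ ν : Fin n → ℤ) (s : ℕ) :
    (∑ i : Fin n, if (i : ℕ) < s then (μ + ν) i else 0) =
      (∑ i : Fin n, if (i : ℕ) < s then μ i else 0) + ∑ i : Fin n, if (i : ℕ) < s then ν i else 0 := by
  rw [← Finset.sum_add_distrib]
  refine Finset.sum_congr rfl fun i _ => ?_
  split_ifs with h
  · rfl
  · rw [add_zero]

/-- Head sums are `ℕ`-homogeneous. [cite: Macdonald1995, Ch. I §1] -/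
theorem sum_ite_lt_nsmul (m : ℕ) (μ : Fin n → ℤ) (s : ℕ) :
    (∑ i : Fin n, if (i : ℕ) < s then (m • μ) i else 0) = m * ∑ i : Fin n, if (i : ℕ) < s then μ i else 0 := by
  rw [Finset.mul_sum]
  refine Finset.sum_congr rfl fun i _ => ?_
  split_ifs with h
  · simp only [Pi.smul_apply, nsmul_eq_mul]
  · rw [mul_zero]

/-- Head sums of a finite sum of vectors. [cite: Macdonald1995, Ch. I §1] -/
theorem sum_ite_lt_finset_sum {ι : Type*} (t : Finset ι) (v : ι → Fin n → ℤ) (s : ℕ) :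
    (∑ i : Fin n, if (i : ℕ) < s then (∑ r ∈ t, v r) i else 0) =
      ∑ r ∈ t, ∑ i : Fin n, if (i : ℕ) < s then v r i else 0 := by
  classical
  induction t using Finset.induction_on with
  | empty =>
    simp only [Finset.sum_empty]
    exact Finset.sum_eq_zero fun i _ => by split_ifs <;> rfl
  | insert r t hr ih => rw [Finset.sum_insert hr, Finset.sum_insert hr, sum_ite_lt_add, ih]

/-- **Products of co-triangular elements are co-triangular with the bottoms added**: if every exponent of `f` (resp.
`g`) is dominance-above `a` (resp. `b`), every exponent of `f g` is dominance-above `a + b`.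
[cite: Macdonald1995, Ch. V (2.6)] [cite: CartierCorvallis1979, §IV, proof of Thm. 4.1 (c)] -/
theorem forall_sum_ite_lt_le_of_coeff_mul_ne_zero {f g : AddMonoidAlgebra R (Fin n → ℤ)} {a b : Fin n → ℤ}
    (hf : ∀ μ, f.coeff μ ≠ 0 → ∀ s : ℕ, (∑ i : Fin n, if (i : ℕ) < s then a i else 0) ≤ ∑ i : Fin n, if (i : ℕ) < s then μ i else 0)
    (hg : ∀ μ, g.coeff μ ≠ 0 → ∀ s : ℕ, (∑ i : Fin n, if (i : ℕ) < s then b i else 0) ≤ ∑ i : Fin n, if (i : ℕ) < s then μ i else 0)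
    {μ : Fin n → ℤ} (hμ : (f * g).coeff μ ≠ 0) (s : ℕ) :
    (∑ i : Fin n, if (i : ℕ) < s then (a + b) i else 0) ≤ ∑ i : Fin n, if (i : ℕ) < s then μ i else 0 := by
  classical
  rw [AddMonoidAlgebra.coeff_mul, Finsupp.sum] at hμ
  obtain ⟨μ₁, hμ₁, h1⟩ := Finset.exists_ne_zero_of_sum_ne_zero hμ
  rw [Finsupp.sum] at h1
  obtain ⟨μ₂, hμ₂, h2⟩ := Finset.exists_ne_zero_of_sum_ne_zero h1
  have h12 : μ₁ + μ₂ = μ := by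
    by_contra h
    exact h2 (if_neg h)
  rw [← h12, sum_ite_lt_add, sum_ite_lt_add]
  exact add_le_add (hf μ₁ (Finsupp.mem_support_iff.1 hμ₁) s) (hg μ₂ (Finsupp.mem_support_iff.1 hμ₂) s)

/-- **… and the bottom coefficients multiply**: the coefficient of `x^{a+b}` in `f g` is `f_a g_b` (no non-vanishing
hypothesis: if `μ₁ + μ₂ = a + b` with `μ₁` above `a` and `μ₂` above `b` then `μ₁ = a`, `μ₂ = b`).
[cite: Macdonald1995, Ch. V (2.6)] [cite: CartierCorvallis1979, §IV, proof of Thm. 4.1 (c)] -/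
theorem coeff_mul_add_eq_mul_coeff_of_forall_sum_ite_lt_le {f g : AddMonoidAlgebra R (Fin n → ℤ)} {a b : Fin n → ℤ}
    (hf : ∀ μ, f.coeff μ ≠ 0 → ∀ s : ℕ, (∑ i : Fin n, if (i : ℕ) < s then a i else 0) ≤ ∑ i : Fin n, if (i : ℕ) < s then μ i else 0)
    (hg : ∀ μ, g.coeff μ ≠ 0 → ∀ s : ℕ, (∑ i : Fin n, if (i : ℕ) < s then b i else 0) ≤ ∑ i : Fin n, if (i : ℕ) < s then μ i else 0) :
    (f * g).coeff (a + b) = f.coeff a * g.coeff b := by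
  classical
  rw [AddMonoidAlgebra.coeff_mul, Finsupp.sum, Finset.sum_eq_single a]
  · rw [Finsupp.sum, Finset.sum_eq_single b]
    · rw [if_pos rfl]
    · intro μ₂ _ hne
      rw [if_neg]
      intro h
      exact hne (add_left_cancel h)
    · intro hb
      rw [Finsupp.notMem_support_iff.1 hb, mul_zero, ite_self]
  · intro μ₁ hμ₁ hne
    rw [Finsupp.sum]
    refine Finset.sum_eq_zero fun μ₂ hμ₂ => ?_
    rw [if_neg]
    intro h
    -- `a ≤ μ₁`, `b ≤ μ₂` head-sum-wise and `μ₁ + μ₂ = a + b` force `μ₁ = a`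
    apply hne
    refine eq_of_forall_sum_ite_lt_eq fun s => le_antisymm ?_ (hf μ₁ (Finsupp.mem_support_iff.1 hμ₁) s)
    have hs := congrArg (fun ρ : Fin n → ℤ => ∑ i : Fin n, if (i : ℕ) < s then ρ i else 0) h
    simp only [sum_ite_lt_add] at hs
    have h2 := hg μ₂ (Finsupp.mem_support_iff.1 hμ₂) s
    omega
  · intro ha
    rw [Finsupp.sum]
    refine Finset.sum_eq_zero fun μ₂ _ => ?_
    rw [Finsupp.notMem_support_iff.1 ha, zero_mul, ite_self]

/-- `1 = x^0`: only the exponent `0` occurs. [cite: Macdonald1995, Ch. V (2.3)] -/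
theorem eq_zero_of_coeff_one_ne_zero {μ : Fin n → ℤ} (h : (1 : AddMonoidAlgebra R (Fin n → ℤ)).coeff μ ≠ 0) : μ = 0 := by
  classical
  rw [AddMonoidAlgebra.one_def, AddMonoidAlgebra.coeff_single] at h
  by_contra hμ
  exact h (Finsupp.single_eq_of_ne hμ)

/-- The coefficient of `x^0` in `1` is `1`. [cite: Macdonald1995, Ch. V (2.3)] -/
theorem coeff_one_zero_eq_one : (1 : AddMonoidAlgebra R (Fin n → ℤ)).coeff 0 = 1 := by
  classical
  rw [AddMonoidAlgebra.one_def, AddMonoidAlgebra.coeff_single, Finsupp.single_eq_same]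

/-- **Powers**: if `y` is co-triangular with bottom `t`, then `y^m` is co-triangular with bottom `m • t` and bottom
coefficient `(y_t)^m`. [cite: Macdonald1995, Ch. V (2.6)–(2.7)] -/
theorem forall_sum_ite_lt_le_and_coeff_pow (y : AddMonoidAlgebra R (Fin n → ℤ)) (t : Fin n → ℤ)
    (hy : ∀ μ, y.coeff μ ≠ 0 → ∀ s : ℕ, (∑ i : Fin n, if (i : ℕ) < s then t i else 0) ≤ ∑ i : Fin n, if (i : ℕ) < s then μ i else 0)
    (m : ℕ) :
    (∀ μ, (y ^ m).coeff μ ≠ 0 →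
        ∀ s : ℕ, (∑ i : Fin n, if (i : ℕ) < s then (m • t) i else 0) ≤ ∑ i : Fin n, if (i : ℕ) < s then μ i else 0) ∧
      (y ^ m).coeff (m • t) = y.coeff t ^ m := by
  induction m with
  | zero =>
    refine ⟨fun μ hμ s => ?_, ?_⟩
    · rw [pow_zero] at hμ
      rw [eq_zero_of_coeff_one_ne_zero hμ, zero_smul]
    · rw [pow_zero, zero_smul, pow_zero]
      exact coeff_one_zero_eq_one
  | succ m ih =>
    refine ⟨fun μ hμ s => ?_, ?_⟩
    · rw [pow_succ] at hμ
      rw [succ_nsmul]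
      exact forall_sum_ite_lt_le_of_coeff_mul_ne_zero ih.1 hy hμ s
    · rw [pow_succ, succ_nsmul, coeff_mul_add_eq_mul_coeff_of_forall_sum_ite_lt_le ih.1 hy, ih.2, pow_succ]

/-- **Monomials in co-triangular elements are co-triangular**, bottom `Σ_r α_r t_r`, bottom coefficient `Π_r (y_r)_{t_r}^{α_r}`.
[cite: Macdonald1995, Ch. V (2.6)–(2.7)] [cite: CartierCorvallis1979, §IV, proof of Thm. 4.1 (c)] -/
theorem forall_sum_ite_lt_le_and_coeff_prod_pow {ι : Type*} (u : Finset ι) (y : ι → AddMonoidAlgebra R (Fin n → ℤ))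
    (t : ι → Fin n → ℤ) (α : ι → ℕ)
    (hy : ∀ r μ, (y r).coeff μ ≠ 0 → ∀ s : ℕ, (∑ i : Fin n, if (i : ℕ) < s then t r i else 0) ≤ ∑ i : Fin n, if (i : ℕ) < s then μ i else 0) :
    (∀ μ, (∏ r ∈ u, y r ^ α r).coeff μ ≠ 0 →
        ∀ s : ℕ, (∑ i : Fin n, if (i : ℕ) < s then (∑ r ∈ u, α r • t r) i else 0) ≤ ∑ i : Fin n, if (i : ℕ) < s then μ i else 0) ∧
      (∏ r ∈ u, y r ^ α r).coeff (∑ r ∈ u, α r • t r) = ∏ r ∈ u, (y r).coeff (t r) ^ α r := by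
  classical
  induction u using Finset.induction_on with
  | empty =>
    refine ⟨fun μ hμ s => ?_, ?_⟩
    · rw [Finset.prod_empty] at hμ
      rw [eq_zero_of_coeff_one_ne_zero hμ, Finset.sum_empty]
    · rw [Finset.prod_empty, Finset.sum_empty, Finset.prod_empty]
      exact coeff_one_zero_eq_one
  | insert r u hr ih =>
    refine ⟨fun μ hμ s => ?_, ?_⟩
    · rw [Finset.prod_insert hr] at hμ
      rw [Finset.sum_insert hr]
      exact forall_sum_ite_lt_le_of_coeff_mul_ne_zero (forall_sum_ite_lt_le_and_coeff_pow (y r) (t r) (hy r) (α r)).1 ih.1 hμ s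
    · rw [Finset.prod_insert hr, Finset.sum_insert hr, Finset.prod_insert hr,
        coeff_mul_add_eq_mul_coeff_of_forall_sum_ite_lt_le (forall_sum_ite_lt_le_and_coeff_pow (y r) (t r) (hy r) (α r)).1 ih.1,
        (forall_sum_ite_lt_le_and_coeff_pow (y r) (t r) (hy r) (α r)).2, ih.2]

/-- **Elements with distinct bottoms and UNIT bottom coefficients are linearly independent over any commutative ring**
(look at the coefficient of a dominance-minimal bottom among the indices with non-zero coefficient: it is `g_j · u` with
`u` a unit). [cite: CartierCorvallis1979, §IV, proof of Thm. 4.1 (b)–(c)] [cite: Macdonald1995, Ch. V (2.7)] -/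
theorem linearIndependent_of_forall_sum_ite_lt_le_of_isUnit {ι : Type*} (m : ι → AddMonoidAlgebra R (Fin n → ℤ))
    (bot : ι → Fin n → ℤ) (hbot : Function.Injective bot)
    (hsupp : ∀ j μ, (m j).coeff μ ≠ 0 → ∀ s : ℕ, (∑ i : Fin n, if (i : ℕ) < s then bot j i else 0) ≤ ∑ i : Fin n, if (i : ℕ) < s then μ i else 0)
    (hlead : ∀ j, IsUnit ((m j).coeff (bot j))) : LinearIndependent R m := by
  classical
  rw [linearIndependent_iff']
  intro u g hsum j hj
  by_contra hgj
  set u' := u.filter fun j => g j ≠ 0 with hu'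
  have hne : u'.Nonempty := ⟨j, Finset.mem_filter.2 ⟨hj, hgj⟩⟩
  -- a dominance-minimal bottom among the indices with non-zero coefficient (maximal for the reversed comparison)
  obtain ⟨j₀, hj₀, hmin⟩ := u'.exists_maximalFor (fun j => OrderDual.toDual fun s : Fin (n + 1) =>
    ∑ i : Fin n, if (i : ℕ) < (s : ℕ) then bot j i else 0) hne
  obtain ⟨hj₀u, hgj₀⟩ := Finset.mem_filter.1 hj₀
  have hcoeff := congrArg (fun x : AddMonoidAlgebra R (Fin n → ℤ) => x.coeff (bot j₀)) hsum
  simp only [AddMonoidAlgebra.coeff_sum, AddMonoidAlgebra.coeff_smul, Finsupp.coe_finsetSum, Finsupp.coe_smul,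
    Finset.sum_apply, Pi.smul_apply, smul_eq_mul, AddMonoidAlgebra.coeff_zero, Finsupp.coe_zero, Pi.zero_apply] at hcoeff
  rw [Finset.sum_eq_single_of_mem j₀ hj₀u] at hcoeff
  · exact hgj₀ ((hlead j₀).mul_left_eq_zero.1 hcoeff)
  · intro j hj hne'
    by_cases hg0 : g j = 0
    · rw [hg0, zero_mul]
    by_cases hm0 : (m j).coeff (bot j₀) = 0
    · rw [hm0, mul_zero]
    exfalso
    apply hne'
    apply hbot
    -- `bot j ≤ bot j₀` (support) and minimality give equality of all head sums
    have hle : (fun s : Fin (n + 1) => ∑ i : Fin n, if (i : ℕ) < (s : ℕ) then bot j i else 0) ≤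
        fun s : Fin (n + 1) => ∑ i : Fin n, if (i : ℕ) < (s : ℕ) then bot j₀ i else 0 := fun s => hsupp j _ hm0 s
    have hle' : (OrderDual.toDual fun s : Fin (n + 1) => ∑ i : Fin n, if (i : ℕ) < (s : ℕ) then bot j₀ i else 0) ≤
        OrderDual.toDual fun s : Fin (n + 1) => ∑ i : Fin n, if (i : ℕ) < (s : ℕ) then bot j i else 0 :=
      OrderDual.toDual_le_toDual.2 hle
    have hge := OrderDual.toDual_le_toDual.1 (hmin (Finset.mem_filter.2 ⟨hj, hg0⟩) hle')
    refine eq_of_forall_sum_ite_lt_eq fun s => ?_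
    wlog hs : s ≤ n generalizing s
    · have h1 : ∀ f : Fin n → ℤ, (∑ i : Fin n, if (i : ℕ) < s then f i else 0) = ∑ i : Fin n, if (i : ℕ) < n then f i else 0 :=
        fun f => Finset.sum_congr rfl fun i _ => by rw [if_pos (by omega), if_pos i.isLt]
      rw [h1, h1]
      exact this n le_rfl
    exact le_antisymm (hle ⟨s, Nat.lt_succ_of_le hs⟩) (hge ⟨s, Nat.lt_succ_of_le hs⟩)

end BottomTerms

/-! ## §2 The counting Satake transform of `T_{ϖ^a}` (`a` monotone) and of the ordered monomials in the `c_{(1^r)}` -/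

section Hecke

variable {F : Type*} [Field F] [ValuativeRel F] {n : ℕ} [IsDiscreteValuationRing 𝒪[F]] {ϖ : F}
  [IsHeckeTriple (⊤ : Submonoid (GL (Fin n) F)) (glInt n F) (glInt n F)] {R : Type*} [CommRing R]

/-- **`𝒮_w(T_{ϖ^a})` is co-triangular with bottom `a`** (`a` monotone, any weight, any commutative ring): every exponent
`μ` with non-zero coefficient is dominance-above `a`, `Σ_{i<s} a_i ≤ Σ_{i<s} μ_i` — Bruhat–Tits (4.4.4) (i) in the
antidominant normalisation (g42-#1) read through the coefficient formula.
[cite: BruhatTits1972, Prop. (4.4.4) (i)] [cite: CartierCorvallis1979, §IV, proof of Thm. 4.1 (c)] -/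
theorem forall_sum_ite_lt_le_of_coeff_satakeTransform_zpowDiagGL_ne_zero (hϖ : IsUniformizingElement ϖ)
    (w : Multiplicative (Fin n → ℤ) →* R) {a : Fin n → ℤ} (ha : Monotone a) {μ : Fin n → ℤ}
    (hμ : ((isIwasawaExponent_gl hϖ).satakeTransform w
      (heckeAlgebra.doubleCosetOperator (glInt n F) (zpowDiagGL hϖ.ne_zero a))).coeff μ ≠ 0) (s : ℕ) :
    (∑ i : Fin n, if (i : ℕ) < s then a i else 0) ≤ ∑ i : Fin n, if (i : ℕ) < s then μ i else 0 := by
  by_contra hlt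
  refine hμ ((isIwasawaExponent_gl hϖ).coeff_satakeTransform_doubleCosetOperator_eq_zero w fun γ hγ he => hlt ?_)
  have hγ' : (γ.out : GL (Fin n) F ⧸ glInt n F) ∈ orbit (glInt n F) (zpowDiagGL hϖ.ne_zero a : GL (Fin n) F ⧸ glInt n F) := by
    rwa [QuotientGroup.out_eq']
  rw [← he]
  exact sum_ite_lt_le_sum_ite_lt_iwasawaExp_of_mem_orbit hϖ ha hγ' s

/-- **The counting transform of `T_{ϖ^a}` has bottom coefficient `1`** (`a` monotone): exactly one coset of `K ϖ^a K` has
Iwasawa exponent `a` (Bruhat–Tits (4.4.4) (ii), g42-#1). [cite: BruhatTits1972, Prop. (4.4.4) (ii)]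
[cite: CartierCorvallis1979, §IV, proof of Thm. 4.1 (c)] -/
theorem coeff_satakeTransform_one_doubleCosetOperator_zpowDiagGL_monotone (hϖ : IsUniformizingElement ϖ)
    {a : Fin n → ℤ} (ha : Monotone a) :
    ((isIwasawaExponent_gl hϖ).satakeTransform (1 : Multiplicative (Fin n → ℤ) →* R)
      (heckeAlgebra.doubleCosetOperator (glInt n F) (zpowDiagGL hϖ.ne_zero a))).coeff a = 1 := by
  rw [coeff_satakeTransform_doubleCosetOperator_zpowDiagGL_monotone hϖ _ ha, MonoidHom.one_apply]

omit [ValuativeRel F] [IsDiscreteValuationRing 𝒪[F]] [IsHeckeTriple (⊤ : Submonoid (GL (Fin n) F)) (glInt n F) (glInt n F)] in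
/-- The exponent `(0^{n-r-1}, 1^{r+1})` (indicator of `rev i ≤ r`) is monotone. [cite: Macdonald1995, Ch. V (2.2)] -/
theorem monotone_indicator_rev_le (r : Fin n) :
    Monotone fun i : Fin n => if ((Fin.rev i : Fin n) : ℕ) ≤ (r : ℕ) then (1 : ℤ) else 0 := by
  intro i j hij
  dsimp only
  have h : ((Fin.rev j : Fin n) : ℕ) ≤ ((Fin.rev i : Fin n) : ℕ) := Fin.rev_le_rev.2 hij
  split_ifs with h1 h2 <;> omega

omit [IsDiscreteValuationRing 𝒪[F]] in
/-- **`c_{(1^{r+1})}` from either exponent**: the double-coset operators of `ϖ^{(1^{r+1}, 0^{n-r-1})}` (the tree's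
generator, `SatakeTransformGLAlgebraicIndependence`) and of `ϖ^{(0^{n-r-1}, 1^{r+1})}` coincide — the exponents differ
by the order-reversing permutation, whose matrix lies in `GL_n(𝒪)`. [cite: Macdonald1995, Ch. V (2.2)] -/
theorem doubleCosetOperator_zpowDiagGL_indicator_le_eq_rev (hϖ0 : ϖ ≠ 0) (r : Fin n) :
    heckeAlgebra.doubleCosetOperator (k := R) (glInt n F)
        (zpowDiagGL hϖ0 fun i : Fin n => if (i : ℕ) ≤ (r : ℕ) then (1 : ℤ) else 0) =
      heckeAlgebra.doubleCosetOperator (k := R) (glInt n F)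
        (zpowDiagGL hϖ0 fun i : Fin n => if ((Fin.rev i : Fin n) : ℕ) ≤ (r : ℕ) then (1 : ℤ) else 0) := by
  obtain ⟨k₁, hk₁, k₂, hk₂, hk⟩ := exists_glInt_mul_zpowDiagGL_mul_eq_of_perm hϖ0
    (a := fun i : Fin n => if (i : ℕ) ≤ (r : ℕ) then (1 : ℤ) else 0)
    (b := fun i : Fin n => if ((Fin.rev i : Fin n) : ℕ) ≤ (r : ℕ) then (1 : ℤ) else 0)
    Fin.revPerm (fun i => by simp only [Fin.revPerm_apply, Fin.rev_rev])
  rw [← hk, heckeAlgebra.doubleCosetOperator_mul_mul_eq (glInt n F) hk₁ hk₂]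

omit [ValuativeRel F] [IsDiscreteValuationRing 𝒪[F]] [IsHeckeTriple (⊤ : Submonoid (GL (Fin n) F)) (glInt n F) (glInt n F)] in
/-- `α ↦ Σ_r α_r (1^{r+1}, 0^{n-r-1})` is injective (`α_i = λ_i - λ_{i+1}`; the tree's g41-#7 has this privately).
[cite: Macdonald1995, Ch. V (2.7)] -/
theorem injective_sum_nsmul_indicator_le :
    Function.Injective fun α : Fin n → ℕ => ∑ r : Fin n, α r • fun i : Fin n => if (i : ℕ) ≤ (r : ℕ) then (1 : ℤ) else 0 := by
  classical
  have hcoord : ∀ (α : Fin n → ℕ) (i : Fin n), (∑ r : Fin n, α r • fun i : Fin n => if (i : ℕ) ≤ (r : ℕ) then (1 : ℤ) else 0) i =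
      ∑ r : Fin n, if (i : ℕ) ≤ (r : ℕ) then (α r : ℤ) else 0 := by
    intro α i
    rw [Finset.sum_apply]
    refine Finset.sum_congr rfl fun r _ => ?_
    rw [Pi.smul_apply]
    split_ifs <;> simp
  have hrec : ∀ (α : Fin n → ℕ) (i : Fin n), (α i : ℤ) =
      (∑ r : Fin n, if (i : ℕ) ≤ (r : ℕ) then (α r : ℤ) else 0) -
        ∑ r : Fin n, if (i : ℕ) + 1 ≤ (r : ℕ) then (α r : ℤ) else 0 := by
    intro α i
    rw [← Finset.sum_sub_distrib]
    have h2 : (∑ r : Fin n, if i = r then (α r : ℤ) else 0) = α i := by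
      rw [Finset.sum_ite_eq, if_pos (Finset.mem_univ _)]
    rw [← h2]
    refine Finset.sum_congr rfl fun r _ => ?_
    by_cases h1 : i = r
    · subst h1
      rw [if_pos rfl, if_pos le_rfl, if_neg (by omega), sub_zero]
    · have h2 : (i : ℕ) ≠ (r : ℕ) := fun h => h1 (Fin.ext h)
      rw [if_neg h1]
      by_cases h3 : (i : ℕ) ≤ (r : ℕ)
      · rw [if_pos h3, if_pos (by omega), sub_self]
      · rw [if_neg h3, if_neg (by omega), sub_zero]
  have hshift : ∀ (α : Fin n → ℕ) (i : Fin n), (∑ r : Fin n, if (i : ℕ) + 1 ≤ (r : ℕ) then (α r : ℤ) else 0) =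
      if h : (i : ℕ) + 1 < n then
        (∑ r : Fin n, α r • fun i : Fin n => if (i : ℕ) ≤ (r : ℕ) then (1 : ℤ) else 0) ⟨(i : ℕ) + 1, h⟩ else 0 := by
    intro α i
    split_ifs with h
    · rw [hcoord]
    · exact Finset.sum_eq_zero fun r _ => if_neg (by have := r.isLt; omega)
  have hfin : ∀ (α : Fin n → ℕ) (i : Fin n), (α i : ℤ) =
      (∑ r : Fin n, α r • fun i : Fin n => if (i : ℕ) ≤ (r : ℕ) then (1 : ℤ) else 0) i -
        (if h : (i : ℕ) + 1 < n then
          (∑ r : Fin n, α r • fun i : Fin n => if (i : ℕ) ≤ (r : ℕ) then (1 : ℤ) else 0) ⟨(i : ℕ) + 1, h⟩ else 0) := by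
    intro α i
    rw [hcoord α i, ← hshift α i]
    exact hrec α i
  intro α β hαβ
  have hαβ' : (∑ r : Fin n, α r • fun i : Fin n => if (i : ℕ) ≤ (r : ℕ) then (1 : ℤ) else 0) =
      ∑ r : Fin n, β r • fun i : Fin n => if (i : ℕ) ≤ (r : ℕ) then (1 : ℤ) else 0 := hαβ
  funext i
  have h := hfin α i
  rw [hαβ'] at h
  exact_mod_cast h.trans (hfin β i).symm

omit [ValuativeRel F] [IsDiscreteValuationRing 𝒪[F]] [IsHeckeTriple (⊤ : Submonoid (GL (Fin n) F)) (glInt n F) (glInt n F)] in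
/-- **`α ↦ Σ_r α_r (0^{n-r-1}, 1^{r+1})` is injective** (it is the previous map composed with index reversal).
[cite: Macdonald1995, Ch. V (2.7)] -/
theorem injective_sum_nsmul_indicator_rev_le :
    Function.Injective fun α : Fin n → ℕ =>
      ∑ r : Fin n, α r • fun i : Fin n => if ((Fin.rev i : Fin n) : ℕ) ≤ (r : ℕ) then (1 : ℤ) else 0 := by
  intro α β hαβ
  refine injective_sum_nsmul_indicator_le (n := n) (funext fun j => ?_)
  have h := congrFun hαβ (Fin.rev j)
  simp only [Finset.sum_apply, Pi.smul_apply, Fin.rev_rev] at h ⊢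
  exact h

/-- **The counting transform of an ordered monomial `Π_r c_{(1^{r+1})}^{α_r}` is co-triangular with bottom
`λ(α) = Σ_r α_r (0^{n-r-1}, 1^{r+1})` and bottom coefficient `1`** (any commutative ring `R`).
[cite: Macdonald1995, Ch. V (2.6)–(2.7)] [cite: CartierCorvallis1979, §IV, proof of Thm. 4.1 (c)]
[cite: BruhatTits1972, Prop. (4.4.4) (ii)] -/
theorem forall_sum_ite_lt_le_and_coeff_satakeTransform_one_monomial (hϖ : IsUniformizingElement ϖ) (α : Fin n → ℕ) :
    (∀ μ, ((isIwasawaExponent_gl hϖ).satakeTransform (1 : Multiplicative (Fin n → ℤ) →* R)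
          (List.ofFn fun r : Fin n => heckeAlgebra.doubleCosetOperator (k := R) (glInt n F)
            (zpowDiagGL hϖ.ne_zero fun i : Fin n => if (i : ℕ) ≤ (r : ℕ) then (1 : ℤ) else 0) ^ α r).prod).coeff μ ≠ 0 →
        ∀ s : ℕ, (∑ i : Fin n, if (i : ℕ) < s then
            (∑ r : Fin n, α r • fun i : Fin n => if ((Fin.rev i : Fin n) : ℕ) ≤ (r : ℕ) then (1 : ℤ) else 0) i else 0) ≤
          ∑ i : Fin n, if (i : ℕ) < s then μ i else 0) ∧
      ((isIwasawaExponent_gl hϖ).satakeTransform (1 : Multiplicative (Fin n → ℤ) →* R)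
          (List.ofFn fun r : Fin n => heckeAlgebra.doubleCosetOperator (k := R) (glInt n F)
            (zpowDiagGL hϖ.ne_zero fun i : Fin n => if (i : ℕ) ≤ (r : ℕ) then (1 : ℤ) else 0) ^ α r).prod).coeff
        (∑ r : Fin n, α r • fun i : Fin n => if ((Fin.rev i : Fin n) : ℕ) ≤ (r : ℕ) then (1 : ℤ) else 0) = 1 := by
  classical
  have hmap : (isIwasawaExponent_gl hϖ).satakeTransform (1 : Multiplicative (Fin n → ℤ) →* R)
      (List.ofFn fun r : Fin n => heckeAlgebra.doubleCosetOperator (k := R) (glInt n F)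
        (zpowDiagGL hϖ.ne_zero fun i : Fin n => if (i : ℕ) ≤ (r : ℕ) then (1 : ℤ) else 0) ^ α r).prod =
      ∏ r : Fin n, ((isIwasawaExponent_gl hϖ).satakeTransform (1 : Multiplicative (Fin n → ℤ) →* R)
        (heckeAlgebra.doubleCosetOperator (k := R) (glInt n F)
          (zpowDiagGL hϖ.ne_zero fun i : Fin n => if ((Fin.rev i : Fin n) : ℕ) ≤ (r : ℕ) then (1 : ℤ) else 0))) ^ α r := by
    rw [map_list_prod, List.map_ofFn, List.prod_ofFn]
    exact Finset.prod_congr rfl fun r _ => by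
      rw [Function.comp_apply, map_pow, doubleCosetOperator_zpowDiagGL_indicator_le_eq_rev]
  have h := forall_sum_ite_lt_le_and_coeff_prod_pow (Finset.univ : Finset (Fin n))
    (fun r : Fin n => (isIwasawaExponent_gl hϖ).satakeTransform (1 : Multiplicative (Fin n → ℤ) →* R)
      (heckeAlgebra.doubleCosetOperator (k := R) (glInt n F)
        (zpowDiagGL hϖ.ne_zero fun i : Fin n => if ((Fin.rev i : Fin n) : ℕ) ≤ (r : ℕ) then (1 : ℤ) else 0)))
    (fun r : Fin n => fun i : Fin n => if ((Fin.rev i : Fin n) : ℕ) ≤ (r : ℕ) then (1 : ℤ) else 0) α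
    (fun r μ hμ s => forall_sum_ite_lt_le_of_coeff_satakeTransform_zpowDiagGL_ne_zero hϖ _ (monotone_indicator_rev_le r) hμ s)
  rw [hmap]
  refine ⟨h.1, ?_⟩
  rw [h.2]
  exact Finset.prod_eq_one fun r _ => by
    rw [coeff_satakeTransform_one_doubleCosetOperator_zpowDiagGL_monotone hϖ (monotone_indicator_rev_le r), one_pow]

/-! ## §3 Linear independence of the ordered monomials and algebraic independence of the `c_{(1^r)}` over any `R` -/

/-- **The ordered monomials `Π_r c_{(1^{r+1})}^{α_r}` are `R`-linearly independent in `ℋ(GL_n(F), GL_n(𝒪_F); R)` for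
EVERY commutative ring `R`** (and every `F` whose valuation ring is a DVR, every uniformizer, as soon as
`(GL_n(F), GL_n(𝒪))` is a Hecke pair): their counting Satake transforms have the distinct bottoms `Σ_r α_r (0, 1^{r+1})`
with bottom coefficient `1` (the tree's `linearIndependent_glInt_monomials_zpowDiagGL` is the case `R = ℂ`).
[cite: Macdonald1995, Ch. V (2.6)–(2.7)] [cite: CartierCorvallis1979, §IV, proof of Thm. 4.1 (b)–(c)]
[cite: BruhatTits1972, Prop. (4.4.4) (ii)] -/
theorem linearIndependent_glInt_monomials_zpowDiagGL_of_commRing (hϖ : IsUniformizingElement ϖ) :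
    LinearIndependent R fun α : Fin n → ℕ => (List.ofFn fun r : Fin n =>
      heckeAlgebra.doubleCosetOperator (k := R) (glInt n F)
        (zpowDiagGL hϖ.ne_zero fun i : Fin n => if (i : ℕ) ≤ (r : ℕ) then (1 : ℤ) else 0) ^ α r).prod := by
  classical
  refine LinearIndependent.of_comp
    ((isIwasawaExponent_gl hϖ).satakeTransform (1 : Multiplicative (Fin n → ℤ) →* R)).toLinearMap ?_
  refine linearIndependent_of_forall_sum_ite_lt_le_of_isUnit _
    (fun α : Fin n → ℕ => ∑ r : Fin n, α r • fun i : Fin n => if ((Fin.rev i : Fin n) : ℕ) ≤ (r : ℕ) then (1 : ℤ) else 0)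
    injective_sum_nsmul_indicator_rev_le (fun α μ hμ s => ?_) (fun α => ?_)
  · rw [Function.comp_apply, AlgHom.toLinearMap_apply] at hμ
    exact (forall_sum_ite_lt_le_and_coeff_satakeTransform_one_monomial hϖ α).1 μ hμ s
  · rw [Function.comp_apply, AlgHom.toLinearMap_apply, (forall_sum_ite_lt_le_and_coeff_satakeTransform_one_monomial hϖ α).2]
    exact isUnit_one

open scoped IsMulCommutative in
/-- **MACDONALD Ch. V (2.7) / SATAKE–TAMAGAWA, INTEGRALLY: the elementary Hecke operators
`c_{(1^r)} = GL_n(𝒪) diag(ϖ, …, ϖ, 1, …, 1) GL_n(𝒪)` (`r` entries `ϖ`, `1 ≤ r ≤ n`) are algebraically independent over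
EVERY commutative ring `R` in the commutative ring `ℋ(GL_n(F), GL_n(𝒪_F); R)`** — for every field `F` whose valuation
ring is a DVR and every uniformizer `ϖ` (commutativity from Gelfand's trick, `GLnHeckeRingCommutative`).  The tree's
`algebraicIndependent_glInt_doubleCosetOperator_zpowDiagGL` is the case `R = ℂ` with finite residue field;
`algebraicIndependent_glInt_doubleCosetOperator_elementary` (g41-#4) the case `e = f = 1`.
[cite: Macdonald1995, Ch. V (2.6)–(2.7)] [cite: CartierCorvallis1979, §IV Thm. 4.1] [cite: BruhatTits1972, Prop. (4.4.4) (ii)] -/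
theorem algebraicIndependent_glInt_doubleCosetOperator_zpowDiagGL_of_commRing (hϖ : IsUniformizingElement ϖ) :
    haveI := isMulCommutative_heckeAlgebra_glInt_of_isDiscreteValuationRing R n (F := F)
    AlgebraicIndependent R fun r : Fin n => heckeAlgebra.doubleCosetOperator (k := R) (glInt n F)
      (zpowDiagGL hϖ.ne_zero fun i : Fin n => if (i : ℕ) ≤ (r : ℕ) then (1 : ℤ) else 0) := by
  classical
  haveI := isMulCommutative_heckeAlgebra_glInt_of_isDiscreteValuationRing R n (F := F)
  have hlin := linearIndependent_glInt_monomials_zpowDiagGL_of_commRing (n := n) (R := R) hϖ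
  rw [algebraicIndependent_iff]
  intro P hP
  have hlin' := hlin.comp (fun d : Fin n →₀ ℕ => (d : Fin n → ℕ)) DFunLike.coe_injective
  have hzero := linearIndependent_iff'ₛ.1 hlin' P.support (fun d => P.coeff d) (fun _ => 0) (by
    simp only [Function.comp_apply, zero_smul, Finset.sum_const_zero]
    rw [MvPolynomial.aeval_def, MvPolynomial.eval₂_eq'] at hP
    rw [← hP]
    refine Finset.sum_congr rfl fun d _ => ?_
    rw [Algebra.smul_def, List.prod_ofFn])
  ext d
  rw [MvPolynomial.coeff_zero]
  by_cases hd : d ∈ P.support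
  · exact hzero d hd
  · exact MvPolynomial.notMem_support_iff.1 hd

open scoped IsMulCommutative in
/-- **`R[c_{(1)}, …, c_{(1ⁿ)}] ⊂ ℋ(GL_n(F), GL_n(𝒪_F); R)` is a polynomial ring in `n` variables over any commutative
`R`**, `X_r ↦ c_{(1^{r+1})}`. [cite: Macdonald1995, Ch. V (2.7)] -/
theorem exists_algEquiv_mvPolynomial_adjoin_glInt_zpowDiagGL_of_commRing (hϖ : IsUniformizingElement ϖ) :
    ∃ e : MvPolynomial (Fin n) R ≃ₐ[R] ↥(Algebra.adjoin R (Set.range fun r : Fin n =>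
        heckeAlgebra.doubleCosetOperator (k := R) (glInt n F)
          (zpowDiagGL hϖ.ne_zero fun i : Fin n => if (i : ℕ) ≤ (r : ℕ) then (1 : ℤ) else 0))),
      ∀ r : Fin n, ((e (MvPolynomial.X r) : ↥(Algebra.adjoin R _)) : heckeAlgebra R (GL (Fin n) F) (glInt n F)) =
        heckeAlgebra.doubleCosetOperator (k := R) (glInt n F)
          (zpowDiagGL hϖ.ne_zero fun i : Fin n => if (i : ℕ) ≤ (r : ℕ) then (1 : ℤ) else 0) := by
  haveI := isMulCommutative_heckeAlgebra_glInt_of_isDiscreteValuationRing R n (F := F)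
  have hx := algebraicIndependent_glInt_doubleCosetOperator_zpowDiagGL_of_commRing (n := n) (R := R) hϖ
  exact ⟨hx.aevalEquiv, fun r => by rw [AlgebraicIndependent.aevalEquiv_apply_coe, MvPolynomial.aeval_X]⟩

end Hecke

end Literature.NumberTheory.Automorphic

end
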